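import Literature.NumberTheory.LFunctions.ConnesProlateGuess
import HarnessLib

/-!
# M2 upper half — a kernel-checked brick of THEOREM E″: the window-edge derivative identity of a prolate function

pub-rhpf cell (M2 seat, generation 3).  HONEST FRAMING: long-odds MECHANISM SEARCH; no RH claims.  Everything in
this file is PROVED (kernel-checked) from the tree's interface `IsProlateFunction` ALONE (its Sturm–Liouville
eigen-equation on the open window and `C²` regularity on the closed window); nothing here mentions zeta.

CONTENT.  For a prolate function `f = h_{n,λ}` (`IsProlateFunction λ n f`, eigen-equation
`−((λ² − y²) f′)′ + (2πλx)² f = χ f` on `(−λ, λ)`), the equation extends by continuity to the CLOSED window, and at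
the edge `x = ±λ` the second-order term drops out:
  `2λ · f′(λ⁻) = (χ − (2πλ²)²) · f(λ)`,   `2λ · f′((−λ)⁺) = −(χ − (2πλ²)²) · f(−λ)`
(`f′(λ⁻)` = the derivative within `[−λ, λ]`; the INTERIOR form of the equation is the tree's
`IsProlateFunction.ode` in `Literature/NumberTheory/LFunctions/ProlateParity.lean` — what is added here is the passage to the closed window and
the two edge identities).  In the unit-interval variables of the prolate literature
(`ψ(t) = λ^{1/2} f(λt)`, `c = 2πλ²`) this is `ψ′(1) = (χ_ψ − c²) ψ(1) / 2` — Lemma 2 of the connes-x13 bundle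
(PROOF-ATTEMPT §3.6) and the `i = 0` case of the endpoint recursion
`2(i+1) ψ^{(i+1)}(1) = [χ − c² − i(i+1)] ψ^{(i)}(1) − 2c² i ψ^{(i−1)}(1) − c² i(i−1) ψ^{(i−2)}(1)` on which the M2 seat's
THEOREM E″ (HOME/M2-ROUTE.md §9, DERIVED on paper, unrefereed) rests.  COROLLARY (PROVED): if `χ < (2πλ²)²` (true for
the prolate parameters in play, bundle (I2); NOT part of the interface, so a hypothesis here) and `f(λ) ≠ 0`, then
`f′(λ⁻) · f(λ) < 0` — the prolate function is strictly decreasing in modulus at the window edge, the mechanism behind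
the smallness-but-nonvanishing of the edge value `ε = |ψ(1)|` that drives the whole leak analysis.
[cite: connes-x13 bundle PROOF-ATTEMPT §3.6 Lemma 2; Osipov–Rokhlin–Xiao, *Prolate Spheroidal Wave Functions of
Order Zero* (2013), the endpoint formula for ψ_n′(1)]
-/

noncomputable section

set_option linter.dupNamespace false  -- the mandated namespace repeats `RiemannHypothesis`

open Set Filter Topology
open Literature.NumberTheory.LFunctions

namespace Summit.RiemannHypothesis.RiemannHypothesis.Theorems.PfPersistenceM2Leak

section ProlateEdge

variable {lam : ℝ} {n : ℕ} {f : ℝ → ℝ}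

/-- **The Sturm–Liouville equation of a prolate function holds on the CLOSED window**, written with the
within-`[−λ, λ]` derivatives `f′_w`, `f″_w`:  `2x f′_w(x) − (λ² − x²) f″_w(x) + ((2πλx)² − χ) f(x) = 0` for every
`x ∈ [−λ, λ]` (on the open window this is the interface's eigen-equation expanded by the product rule; at the two
edges it follows by continuity of `f, f′_w, f″_w` on the closed window). -/
theorem prolate_eqOn_Icc_of_eigen (h : IsProlateFunction lam n f) {χ : ℝ}
    (hχ : ∀ x ∈ Ioo (-lam) lam,
      -(deriv (fun y ↦ (lam ^ 2 - y ^ 2) * deriv f y) x) + (2 * Real.pi * lam * x) ^ 2 * f x = χ * f x) :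
    ∀ x ∈ Icc (-lam) lam,
      2 * x * derivWithin f (Icc (-lam) lam) x
        - (lam ^ 2 - x ^ 2) * derivWithin (derivWithin f (Icc (-lam) lam)) (Icc (-lam) lam) x
        + ((2 * Real.pi * lam * x) ^ 2 - χ) * f x = 0 := by
  have hl : 0 < lam := h.lam_pos
  have hll : -lam < lam := by linarith
  -- notation
  set s : Set ℝ := Icc (-lam) lam with hs_def
  have hs : UniqueDiffOn ℝ s := uniqueDiffOn_Icc hll
  set f1 : ℝ → ℝ := derivWithin f s with hf1_def
  set f2 : ℝ → ℝ := derivWithin f1 s with hf2_def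
  have hf : ContDiffOn ℝ 2 f s := h.contDiffOn
  have hf1 : ContDiffOn ℝ 1 f1 s := hf.derivWithin hs (by norm_num)
  have hfc : ContinuousOn f s := hf.continuousOn
  have hf1c : ContinuousOn f1 s := hf1.continuousOn
  have hf2c : ContinuousOn f2 s := hf1.continuousOn_derivWithin hs le_rfl
  -- the defect function
  set g : ℝ → ℝ := fun x ↦ 2 * x * f1 x - (lam ^ 2 - x ^ 2) * f2 x
      + ((2 * Real.pi * lam * x) ^ 2 - χ) * f x with hg_def
  have hgc : ContinuousOn g s := by
    have h2x : ContinuousOn (fun x : ℝ ↦ 2 * x) s := (continuous_const.mul continuous_id).continuousOn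
    have hq : ContinuousOn (fun x : ℝ ↦ lam ^ 2 - x ^ 2) s :=
      (continuous_const.sub (continuous_id.pow 2)).continuousOn
    have hc : ContinuousOn (fun x : ℝ ↦ (2 * Real.pi * lam * x) ^ 2 - χ) s :=
      (((continuous_const.mul continuous_id).pow 2).sub continuous_const).continuousOn
    exact ((h2x.mul hf1c).sub (hq.mul hf2c)).add (hc.mul hfc)
  -- g vanishes on the open window
  have hg0 : EqOn g 0 (Ioo (-lam) lam) := by
    intro x hx
    have hsx : s ∈ 𝓝 x := Icc_mem_nhds hx.1 hx.2
    have hox : Ioo (-lam) lam ∈ 𝓝 x := Ioo_mem_nhds hx.1 hx.2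
    -- `deriv f = f1` near `x`
    have hEq : ∀ᶠ y in 𝓝 x, deriv f y = f1 y := by
      filter_upwards [hox] with y hy
      rw [hf1_def, derivWithin_of_mem_nhds (Icc_mem_nhds hy.1 hy.2)]
    -- `f1` is differentiable at `x` with derivative `f2 x`
    have hf1d : DifferentiableAt ℝ f1 x :=
      ((hf1.differentiableOn one_ne_zero) x (Ioo_subset_Icc_self hx)).differentiableAt hsx
    have hf1' : HasDerivAt f1 (f2 x) x := by
      have : f2 x = deriv f1 x := by rw [hf2_def, derivWithin_of_mem_nhds hsx]
      rw [this]; exact hf1d.hasDerivAt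
    have hq' : HasDerivAt (fun y : ℝ ↦ lam ^ 2 - y ^ 2) (-(2 * x)) x := by
      have := ((hasDerivAt_id x).pow 2).const_sub (lam ^ 2)
      simpa using this
    have hprod : HasDerivAt (fun y ↦ (lam ^ 2 - y ^ 2) * f1 y)
        (-(2 * x) * f1 x + (lam ^ 2 - x ^ 2) * f2 x) x := hq'.mul hf1'
    have hfun : (fun y ↦ (lam ^ 2 - y ^ 2) * deriv f y) =ᶠ[𝓝 x] fun y ↦ (lam ^ 2 - y ^ 2) * f1 y := by
      filter_upwards [hEq] with y hy
      rw [hy]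
    have hder : deriv (fun y ↦ (lam ^ 2 - y ^ 2) * deriv f y) x
        = -(2 * x) * f1 x + (lam ^ 2 - x ^ 2) * f2 x := by
      rw [hfun.deriv_eq]; exact hprod.deriv
    have hx' := hχ x hx
    rw [hder] at hx'
    simp only [hg_def, Pi.zero_apply]
    linarith
  -- extend to the closed window by continuity
  have hgI : EqOn g 0 s :=
    hg0.of_subset_closure hgc continuousOn_const Ioo_subset_Icc_self
      (by rw [closure_Ioo hll.ne])
  intro x hx
  have := hgI hx
  simpa only [hg_def, Pi.zero_apply] using this

/-- **Window-edge derivative identity (right edge).**  `2λ · f′_w(λ) = (χ − (2πλ²)²) · f(λ)` — in prolate variables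
`ψ′(1) = (χ_ψ − c²) ψ(1) / 2`, the `i = 0` case of the endpoint recursion behind THEOREM E″. -/
theorem prolate_derivWithin_right_edge (h : IsProlateFunction lam n f) {χ : ℝ}
    (hχ : ∀ x ∈ Ioo (-lam) lam,
      -(deriv (fun y ↦ (lam ^ 2 - y ^ 2) * deriv f y) x) + (2 * Real.pi * lam * x) ^ 2 * f x = χ * f x) :
    2 * lam * derivWithin f (Icc (-lam) lam) lam = (χ - (2 * Real.pi * lam ^ 2) ^ 2) * f lam := by
  have hl : 0 < lam := h.lam_pos
  have hmem : lam ∈ Icc (-lam) lam := ⟨by linarith, le_rfl⟩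
  have := prolate_eqOn_Icc_of_eigen h hχ lam hmem
  have h0 : lam ^ 2 - lam ^ 2 = 0 := sub_self _
  rw [h0, zero_mul, sub_zero] at this
  have e : (2 * Real.pi * lam * lam) ^ 2 = (2 * Real.pi * lam ^ 2) ^ 2 := by ring
  rw [e] at this
  linarith

/-- **Window-edge derivative identity (left edge).**  `2λ · f′_w(−λ) = −(χ − (2πλ²)²) · f(−λ)`. -/
theorem prolate_derivWithin_left_edge (h : IsProlateFunction lam n f) {χ : ℝ}
    (hχ : ∀ x ∈ Ioo (-lam) lam,
      -(deriv (fun y ↦ (lam ^ 2 - y ^ 2) * deriv f y) x) + (2 * Real.pi * lam * x) ^ 2 * f x = χ * f x) :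
    2 * lam * derivWithin f (Icc (-lam) lam) (-lam) = -((χ - (2 * Real.pi * lam ^ 2) ^ 2) * f (-lam)) := by
  have hl : 0 < lam := h.lam_pos
  have hmem : -lam ∈ Icc (-lam) lam := ⟨le_rfl, by linarith⟩
  have := prolate_eqOn_Icc_of_eigen h hχ (-lam) hmem
  have h0 : lam ^ 2 - (-lam) ^ 2 = 0 := by ring
  rw [h0, zero_mul, sub_zero] at this
  have e : (2 * Real.pi * lam * -lam) ^ 2 = (2 * Real.pi * lam ^ 2) ^ 2 := by ring
  rw [e] at this
  linarith

/-- **Existential packaging over the interface's own eigenvalue**: every prolate function satisfies the two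
edge identities for the `χ` of `IsProlateFunction.eigen`. -/
theorem prolate_exists_edge_identities (h : IsProlateFunction lam n f) :
    ∃ χ : ℝ, (∀ x ∈ Ioo (-lam) lam,
        -(deriv (fun y ↦ (lam ^ 2 - y ^ 2) * deriv f y) x) + (2 * Real.pi * lam * x) ^ 2 * f x = χ * f x) ∧
      2 * lam * derivWithin f (Icc (-lam) lam) lam = (χ - (2 * Real.pi * lam ^ 2) ^ 2) * f lam ∧
      2 * lam * derivWithin f (Icc (-lam) lam) (-lam) = -((χ - (2 * Real.pi * lam ^ 2) ^ 2) * f (-lam)) := by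
  obtain ⟨χ, hχ⟩ := h.eigen
  exact ⟨χ, hχ, prolate_derivWithin_right_edge h hχ, prolate_derivWithin_left_edge h hχ⟩

/-- **COROLLARY (the edge mechanism).**  If the eigenvalue lies below `c² = (2πλ²)²` (bundle (I2); a hypothesis
here, not part of the interface) and the edge value is non-zero, then `f′_w(λ) · f(λ) < 0`: a prolate function
strictly decreases in modulus at the window edge. -/
theorem prolate_derivWithin_mul_self_neg_right_edge (h : IsProlateFunction lam n f) {χ : ℝ}
    (hχ : ∀ x ∈ Ioo (-lam) lam,
      -(deriv (fun y ↦ (lam ^ 2 - y ^ 2) * deriv f y) x) + (2 * Real.pi * lam * x) ^ 2 * f x = χ * f x)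
    (hχc : χ < (2 * Real.pi * lam ^ 2) ^ 2) (hf : f lam ≠ 0) :
    derivWithin f (Icc (-lam) lam) lam * f lam < 0 := by
  have hl : 0 < lam := h.lam_pos
  have hid := prolate_derivWithin_right_edge h hχ
  have hsq : 0 < f lam ^ 2 := by positivity
  have key : 2 * lam * (derivWithin f (Icc (-lam) lam) lam * f lam)
      = (χ - (2 * Real.pi * lam ^ 2) ^ 2) * f lam ^ 2 := by
    rw [← mul_assoc, hid]; ring
  have hneg : (χ - (2 * Real.pi * lam ^ 2) ^ 2) * f lam ^ 2 < 0 :=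
    mul_neg_of_neg_of_pos (by linarith) hsq
  nlinarith

/-- **Log-derivative form at the edge** (the shape used in E″'s bookkeeping, `ψ′(1)/ψ(1) = (χ − c²)/2`):
`f′_w(λ) / f(λ) = (χ − (2πλ²)²) / (2λ)` whenever `f(λ) ≠ 0`. -/
theorem prolate_derivWithin_div_right_edge (h : IsProlateFunction lam n f) {χ : ℝ}
    (hχ : ∀ x ∈ Ioo (-lam) lam,
      -(deriv (fun y ↦ (lam ^ 2 - y ^ 2) * deriv f y) x) + (2 * Real.pi * lam * x) ^ 2 * f x = χ * f x)
    (hf : f lam ≠ 0) :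
    derivWithin f (Icc (-lam) lam) lam / f lam = (χ - (2 * Real.pi * lam ^ 2) ^ 2) / (2 * lam) := by
  have hl : 0 < lam := h.lam_pos
  have hid := prolate_derivWithin_right_edge h hχ
  rw [div_eq_div_iff hf (by positivity)]
  linarith [hid]

end ProlateEdge

end Summit.RiemannHypothesis.RiemannHypothesis.Theorems.PfPersistenceM2Leak

end
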